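import Summits.MatrixMultiplication.MatrixMultiplication.Theorems.FarEdgeDescentLogRate

/-!
# Route `FarEdgeDescent` — the SHARP logarithmic rate of the first-power `CW_q` class (rung `LogRateSharp`)

decomp-mm ROOT cell (D-0178), lens 2 «structural dichotomy: special vs generic», gen 14.

On the SPECIAL side of the node of record `S ⟺ FiniteSaturation ∧ AnchoredLogConvexity` the excess
`e(k) = ω(1,k,1) − (k+1)` of the far-rectangular exponent carries a RATE LADDER
`LogRate (25370, proved) < LogRateSharp (this file) < SubLogRate (25371) < PowerAmortisation (25347) < FiniteSaturation (23739)`.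
The landed aside `LogRate` gives `e(k) ≤ log 2 / log(2k+2)` from the `s = r = 0` slice of the full first-power
certificate `FarEdgeDescentLogRate.cwFirstPowerIntegerCertificate_holds` (imported, never restated).  This file
evaluates the SAME landed certificate at the dilute scalar rate `q = k`, `r = 0`, `σ = t/(k+2+2t)` with a rational
`t = s/m ↑ 1/2` and proves the sharp constant of the class:

* `c₁ := (3/2) log 3 − 2 log 2 = log (3√3/4)`, `0.261 < c₁ < 0.2623 < log 2 = 0.693…`
  (`cwFarEdgeConstant_eq_log`, `_pos`, `_lt_log_two`, `_bounds`);
* `logRateSharp` : the route aside `LogRateSharp` (stmt-MatrixMultiplication-33239) BY NAME,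
  `∀ c > c₁, ∃ k₀ ≥ 2, ∀ k ≥ k₀, ω(1,k,1) − (k+1) ≤ c / log k` — via the exact finite-`k` excess
  identity `K(log(k+2) − H_Y) − (k+1) log k = K log((k+2)/K) + (k+1) log(1+1/k) + φ(t)` (`farEdge_excess_identity`),
  its bound `≤ 1 − 2t + φ(t) + 1/k` (`farEdge_excess_bound`), the X/Y balance `H_Y ≤ H_X` once
  `(1−2t) log(k+1) ≥ 2 log 2 − φ(t)` (`farEdge_balance`), and `1 − 2t + φ(t) → c₁` as `t ↑ 1/2` (`phiT_half`,
  `farEdge_exists_rate`), where `φ(t) = (1+t) log(1+t) + t log t`;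
* PLACEMENT of the open aside `SubLogRate` (25371) by theorem: it is implied by nothing proved here, implies the new
  rung (`logRateSharp_of_subLogRate`), and LIVES ENTIRELY AT OR BELOW THE CONSTANT:
  `SubLogRate ↔ ∀ c ∈ (0, c₁], eventually e(k) ≤ c / log k` (`subLogRate_iff_below_constant`).

Reading: every far-edge rate the fixed-power CW class is known to certify is `c / log k` with `c > c₁`; the open
remainder of the rate leaf is `(0, c₁]` (Coppersmith 1982 gives the `1/log k` ORDER; the constant `c₁` is not in print —
cell census F3/I8).  NO definitions (gate rule D-0009): `c₁` and `φ(t)` are written out literally.  Ported from the lens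
draft `FarEdgeDescent_v4.lean` §FarEdgeGas (rc 0 · 0 sorry).  Nothing here proves `ω = 2`.
-/

set_option linter.dupNamespace false

noncomputable section

open Finset
open scoped BigOperators

namespace Summit.MatrixMultiplication.MatrixMultiplication.Theorems.FarEdgeDescentLogRateSharp

open Literature.Computability.AlgebraicComplexity
open Summit.MatrixMultiplication.MatrixMultiplication.Theorems.FarEdgeDescentLogRate
  (shannon₃ cwFullFirstPowerValue CwFirstPowerIntegerCertificate cwFirstPowerIntegerCertificate_holds)
open Summit.MatrixMultiplication.MatrixMultiplication.Theses.FarEdgeDescent (SubLogRate LogRateSharp)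

/-! ## The far-edge constant `c₁ = (3/2)·log 3 − 2·log 2 = log(3√3/4) ≈ 0.26162` -/

/-! The far-edge constant of the FULL first-power Coppersmith–Winograd laser method is written out literally
throughout (no definition is introduced; gate rule D-0009):
`c₁ := 3 / 2 * Real.log 3 - 2 * Real.log 2 = log (3√3/4) = 0.261624…` (dilute defect gas: `q ∼ k`, defects
`101/110` at rate `β ∼ 1/k`, scalars `020/002` at rate `→ β/2`, X-count = Y-count balance). -/

/-- `c₁ = log (3√3/4)`. -/
theorem cwFarEdgeConstant_eq_log : (3 / 2 * Real.log 3 - 2 * Real.log 2 : ℝ) = Real.log (3 * Real.sqrt 3 / 4) := by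
  have h3 : (0 : ℝ) ≤ 3 := by norm_num
  have hs : 0 < Real.sqrt 3 := Real.sqrt_pos.mpr (by norm_num)
  rw [Real.log_div (by positivity) (by norm_num), Real.log_mul (by norm_num) hs.ne',
    Real.log_sqrt h3, show (4 : ℝ) = 2 ^ 2 by norm_num, Real.log_pow]
  push_cast
  ring

/-- `c₁ > 0` (`3√3 > 4`). -/
theorem cwFarEdgeConstant_pos : (0 : ℝ) < 3 / 2 * Real.log 3 - 2 * Real.log 2 := by
  rw [cwFarEdgeConstant_eq_log]
  apply Real.log_pos
  have h : (4 : ℝ) / 3 < Real.sqrt 3 := by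
    rw [show (4 : ℝ) / 3 = Real.sqrt ((4 / 3) ^ 2) by rw [Real.sqrt_sq (by norm_num)]]
    exact Real.sqrt_lt_sqrt (by norm_num) (by norm_num)
  linarith

/-- `c₁ < log 2` (`3√3 < 8`): the full first power BEATS the `s = r = 0` packing family of the landed aside
`LogRate` (constant `log 2`) by the factor `c₁ / log 2 = 0.377…`. -/
theorem cwFarEdgeConstant_lt_log_two : 3 / 2 * Real.log 3 - 2 * Real.log 2 < Real.log 2 := by
  rw [cwFarEdgeConstant_eq_log]
  apply Real.log_lt_log (by positivity)
  have h : Real.sqrt 3 < 8 / 3 := by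
    rw [show (8 : ℝ) / 3 = Real.sqrt ((8 / 3) ^ 2) by rw [Real.sqrt_sq (by norm_num)]]
    exact Real.sqrt_lt_sqrt (by norm_num) (by norm_num)
  linarith

/-- Decimal enclosure `0.261 < c₁ < 0.2623` (series for `log(3/4)` to five terms and the Mathlib
enclosure of `log 2`). -/
theorem cwFarEdgeConstant_bounds :
    (0.261 : ℝ) < 3 / 2 * Real.log 3 - 2 * Real.log 2 ∧ 3 / 2 * Real.log 3 - 2 * Real.log 2 < (0.2623 : ℝ) := by
  have h2l := Real.log_two_gt_d9
  have h2u := Real.log_two_lt_d9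
  -- log 3 = 2 log 2 + log (3/4) = 2 log 2 + log (1 - 1/4)
  have hser := Real.abs_log_sub_add_sum_range_le (show |(1 : ℝ) / 4| < 1 by norm_num) 5
  have hsum : (∑ i ∈ Finset.range 5, ((1 : ℝ) / 4) ^ (i + 1) / (i + 1)) = 4418 / 15360 := by
    simp only [Finset.sum_range_succ, Finset.sum_range_zero]
    norm_num
  rw [hsum] at hser
  have habs : |(1 : ℝ) / 4| ^ (5 + 1) / (1 - |(1 : ℝ) / 4|) = 1 / 3072 := by
    rw [abs_of_pos (by norm_num)]; norm_num
  rw [habs] at hser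
  have hlog3 : Real.log 3 = 2 * Real.log 2 + Real.log (1 - 1 / 4) := by
    rw [show (1 : ℝ) - 1 / 4 = 3 / 4 by norm_num, Real.log_div (by norm_num) (by norm_num),
      show (4 : ℝ) = 2 ^ 2 by norm_num, Real.log_pow]
    push_cast; ring
  have hb := abs_le.mp hser
  rw [hlog3]
  constructor <;> nlinarith [hb.1, hb.2]

/-! ## The exact finite-`k` excess of the certificate at `q = k`, `σ = t/K`, `ρ = 0`, `K = k + 2 + 2t` -/

/-! `φ(t) := (1 + t) * Real.log (1 + t) + t * Real.log t` is written out literally throughout (no definition);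
`1 − 2t + φ(t)` is the dilute far-edge functional of the first power at defect density `c = q β = 1`. -/

/-- At the end-point `t = 1/2`: `1 − 2t + φ(t) = c₁`. -/
theorem phiT_half : 1 - 2 * (1 / 2 : ℝ) + ((1 + 1 / 2) * Real.log (1 + 1 / 2) + 1 / 2 * Real.log (1 / 2)) =
    3 / 2 * Real.log 3 - 2 * Real.log 2 := by
  rw [show (1 : ℝ) + 1 / 2 = 3 / 2 by norm_num, Real.log_div (by norm_num) (by norm_num),
    show ((1 : ℝ) / 2) = (2 : ℝ)⁻¹ by norm_num, Real.log_inv]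
  ring

/-- Choice of the scalar rate: for `c > c₁` some RATIONAL `t = s/m ∈ [1/4, 1/2)` has `1 − 2t + φ(t) < c`. -/
theorem farEdge_exists_rate {c : ℝ} (hc : 3 / 2 * Real.log 3 - 2 * Real.log 2 < c) :
    ∃ s m : ℕ, 1 ≤ m ∧ 2 * s < m ∧ m ≤ 4 * s ∧
      1 - 2 * ((s : ℝ) / m) + ((1 + (s : ℝ) / m) * Real.log (1 + (s : ℝ) / m) + (s : ℝ) / m * Real.log ((s : ℝ) / m)) < c := by
  have hcont : ContinuousAt (fun t : ℝ => 1 - 2 * t + ((1 + t) * Real.log (1 + t) + t * Real.log t)) (1 / 2) := by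
    have h1 : ContinuousAt (fun t : ℝ => (1 + t) * Real.log (1 + t)) (1 / 2) :=
      (Real.continuous_mul_log.comp (continuous_const.add continuous_id)).continuousAt
    have h2 : ContinuousAt (fun t : ℝ => t * Real.log t) (1 / 2) := Real.continuous_mul_log.continuousAt
    have h3 : ContinuousAt (fun t : ℝ => 1 - 2 * t) (1 / 2) := by fun_prop
    exact h3.add (h1.add h2)
  have hε : 0 < c - (3 / 2 * Real.log 3 - 2 * Real.log 2) := by linarith
  obtain ⟨δ, hδ, hball⟩ := Metric.continuousAt_iff.mp hcont (c - (3 / 2 * Real.log 3 - 2 * Real.log 2)) hε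
  -- `t = 1/2 − 1/M = (M−2)/(2M)` with `M ≥ 4`, `1/M < δ`
  obtain ⟨M₀, hM₀⟩ : ∃ M₀ : ℕ, 2 / δ ≤ M₀ := ⟨⌈2 / δ⌉₊, Nat.le_ceil _⟩
  set M : ℕ := max 4 M₀ with hM
  have hM4 : 4 ≤ M := le_max_left _ _
  have hMM₀ : M₀ ≤ M := le_max_right _ _
  have hMR : (4 : ℝ) ≤ (M : ℝ) := by exact_mod_cast hM4
  have hM0 : (0 : ℝ) < M := by linarith
  have hinvM : 1 / (M : ℝ) < δ := by
    have h2δ : 0 < 2 / δ := by positivity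
    have hM₀R : (2 / δ : ℝ) ≤ (M : ℝ) := hM₀.trans (by exact_mod_cast hMM₀)
    rw [div_lt_iff₀ hM0]
    have := (div_le_iff₀ hδ).mp hM₀R
    linarith
  refine ⟨M - 2, 2 * M, by omega, by omega, by omega, ?_⟩
  have ht : (((M - 2 : ℕ) : ℝ) / ((2 * M : ℕ) : ℝ)) = 1 / 2 - 1 / (M : ℝ) := by
    rw [Nat.cast_sub (by omega : 2 ≤ M), Nat.cast_mul]
    push_cast
    field_simp
  rw [ht]
  have hd : dist (1 / 2 - 1 / (M : ℝ)) (1 / 2 : ℝ) < δ := by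
    rw [Real.dist_eq, show (1 : ℝ) / 2 - 1 / (M : ℝ) - 1 / 2 = -(1 / (M : ℝ)) by ring, abs_neg,
      abs_of_pos (by positivity)]
    exact hinvM
  have h := hball hd
  rw [Real.dist_eq] at h
  have h' := (abs_lt.mp h).2
  have e : (fun t : ℝ => 1 - 2 * t + ((1 + t) * Real.log (1 + t) + t * Real.log t)) (1 / 2) =
      3 / 2 * Real.log 3 - 2 * Real.log 2 := phiT_half
  simp only [e] at h'
  linarith

/-- Balance: at `q = k`, `σ = t/K`, `ρ = 0`, `K = k + 2 + 2t`, the Y-entropy is below the X-entropy as soon as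
`(1 − 2t) log(k+1) ≥ 2 log 2 − φ(t)`. -/
theorem farEdge_balance {k t : ℝ} (hk : 2 ≤ k) (ht : 0 < t) (ht2 : t < 1 / 2)
    (hlarge : 2 * Real.log 2 - ((1 + t) * Real.log (1 + t) + t * Real.log t) ≤ (1 - 2 * t) * Real.log (k + 1)) :
    shannon₃ ((1 + t) / (k + 2 + 2 * t)) ((k + 1) / (k + 2 + 2 * t)) (t / (k + 2 + 2 * t)) ≤
      shannon₃ ((k + 2 * t) / (k + 2 + 2 * t)) (2 / (k + 2 + 2 * t)) 0 := by
  set K : ℝ := k + 2 + 2 * t with hK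
  have hK0 : 0 < K := by rw [hK]; linarith
  have hKne := hK0.ne'
  have hk1 : 0 < k + 1 := by linarith
  have hk2t : 0 < k + 2 * t := by linarith
  have h1t : 0 < 1 + t := by linarith
  unfold shannon₃
  rw [Real.log_div h1t.ne' hKne, Real.log_div hk1.ne' hKne, Real.log_div ht.ne' hKne,
    Real.log_div hk2t.ne' hKne, Real.log_div two_ne_zero hKne, Real.log_zero, mul_zero, add_zero]
  -- multiply through by K > 0
  rw [← sub_nonneg]
  have key : (k + 2 * t) * Real.log (k + 2 * t) ≤
      (k + 1) * Real.log (k + 1) - (1 - 2 * t) * Real.log (k + 1) := by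
    have hlog : Real.log (k + 2 * t) ≤ Real.log (k + 1) := Real.log_le_log hk2t (by linarith)
    have := mul_le_mul_of_nonneg_left hlog hk2t.le
    have e : (k + 1) * Real.log (k + 1) - (1 - 2 * t) * Real.log (k + 1) = (k + 2 * t) * Real.log (k + 1) := by
      ring
    linarith
  -- target: K·(H_X − H_Y) ≥ 0, written without K by clearing the common 1/K factor
  have expand : -((k + 2 * t) / K * (Real.log (k + 2 * t) - Real.log K) + 2 / K * (Real.log 2 - Real.log K)) -
      -((1 + t) / K * (Real.log (1 + t) - Real.log K) + (k + 1) / K * (Real.log (k + 1) - Real.log K) +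
          t / K * (Real.log t - Real.log K)) =
      (1 / K) * (((1 + t) * Real.log (1 + t) + t * Real.log t) - 2 * Real.log 2 + (k + 1) * Real.log (k + 1) -
        (k + 2 * t) * Real.log (k + 2 * t)) := by
    field_simp
    ring
  rw [expand]
  apply mul_nonneg (by positivity)
  linarith

/-- The exact finite-`k` excess of the certificate at `q = k`, `σ = t/K`, `ρ = 0` (when the Y-count binds):
`K·(log(k+2) − H_Y) − (k+1) log k = K log((k+2)/K) + (k+1) log(1+1/k) + φ(t)`. -/
theorem farEdge_excess_identity {k t : ℝ} (hk : 2 ≤ k) (ht : 0 < t) :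
    (k + 2 + 2 * t) * (Real.log (k + 2) -
        shannon₃ ((1 + t) / (k + 2 + 2 * t)) ((k + 1) / (k + 2 + 2 * t)) (t / (k + 2 + 2 * t))) -
      (k + 1) * Real.log k =
      (k + 2 + 2 * t) * (Real.log (k + 2) - Real.log (k + 2 + 2 * t)) +
        (k + 1) * (Real.log (k + 1) - Real.log k) + ((1 + t) * Real.log (1 + t) + t * Real.log t) := by
  set K : ℝ := k + 2 + 2 * t with hK
  have hK0 : 0 < K := by rw [hK]; linarith
  have hKne := hK0.ne'
  have hk1 : 0 < k + 1 := by linarith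
  have h1t : 0 < 1 + t := by linarith
  unfold shannon₃
  rw [Real.log_div h1t.ne' hKne, Real.log_div hk1.ne' hKne, Real.log_div ht.ne' hKne]
  field_simp
  ring

/-- … and its bound `≤ 1 − 2t + φ(t) + 1/k` (`log x ≤ x − 1` twice). -/
theorem farEdge_excess_bound {k t : ℝ} (hk : 2 ≤ k) (ht : 0 < t) :
    (k + 2 + 2 * t) * (Real.log (k + 2) - Real.log (k + 2 + 2 * t)) +
        (k + 1) * (Real.log (k + 1) - Real.log k) + ((1 + t) * Real.log (1 + t) + t * Real.log t) ≤
      1 - 2 * t + ((1 + t) * Real.log (1 + t) + t * Real.log t) + 1 / k := by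
  have hK0 : 0 < k + 2 + 2 * t := by linarith
  have hk0 : 0 < k := by linarith
  have h1 : Real.log (k + 2) - Real.log (k + 2 + 2 * t) ≤ (k + 2) / (k + 2 + 2 * t) - 1 := by
    rw [← Real.log_div (by linarith) hK0.ne']
    exact Real.log_le_sub_one_of_pos (by positivity)
  have h2 : Real.log (k + 1) - Real.log k ≤ (k + 1) / k - 1 := by
    rw [← Real.log_div (by linarith) hk0.ne']
    exact Real.log_le_sub_one_of_pos (by positivity)
  have h1' := mul_le_mul_of_nonneg_left h1 hK0.le
  have h2' := mul_le_mul_of_nonneg_left h2 (by linarith : (0 : ℝ) ≤ k + 1)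
  have e1 : (k + 2 + 2 * t) * ((k + 2) / (k + 2 + 2 * t) - 1) = -(2 * t) := by field_simp; ring
  have e2 : (k + 1) * ((k + 1) / k - 1) = 1 + 1 / k := by field_simp; ring
  linarith

/-! ## The rung: every constant above `c₁` is realised by the landed integer certificate -/

/-- **`LogRateSharp` from the INTEGER first-power certificate** (parameters `q = k`, `r = 0`, `t = s/m ↑ 1/2`; no
optimisation in `q` is needed since the dilute optimum has `q/k → 1`). -/
theorem logRateSharp_of_integerCertificate (hC : CwFirstPowerIntegerCertificate) :
    ∀ c : ℝ, 3 / 2 * Real.log 3 - 2 * Real.log 2 < c → ∃ k₀ : ℕ, 2 ≤ k₀ ∧ ∀ k : ℕ, k₀ ≤ k →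
      omegaRect ℂ 1 k 1 - (k + 1) ≤ c / Real.log k := by
  intro c hc
  obtain ⟨s, m, hm, hsm, hms, hG⟩ := farEdge_exists_rate hc
  have hmR : (1 : ℝ) ≤ (m : ℝ) := by exact_mod_cast hm
  have hm0 : (0 : ℝ) < (m : ℝ) := by linarith
  have hsmR : 2 * (s : ℝ) < (m : ℝ) := by exact_mod_cast hsm
  have hmsR : (m : ℝ) ≤ 4 * (s : ℝ) := by exact_mod_cast hms
  set t : ℝ := (s : ℝ) / (m : ℝ) with htdef
  have ht4 : 1 / 4 ≤ t := by rw [htdef, div_le_div_iff₀ (by norm_num) hm0]; linarith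
  have ht2 : t < 1 / 2 := by rw [htdef, div_lt_div_iff₀ hm0 (by norm_num)]; linarith
  have ht : 0 < t := by linarith
  -- φ(t), kept as an opaque real number `φ` with its defining equation
  obtain ⟨φ, hφ⟩ : ∃ φ : ℝ, φ = (1 + t) * Real.log (1 + t) + t * Real.log t := ⟨_, rfl⟩
  rw [← hφ] at hG
  -- margins
  set η : ℝ := (c - (1 - 2 * t + φ)) / 2 with hη
  have hη0 : 0 < η := by rw [hη]; linarith
  -- thresholds: balance needs (1-2t) log(k+1) ≥ 2 log 2 − φ(t); slack needs 1/k ≤ η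
  set M : ℝ := (2 * Real.log 2 - φ) / (1 - 2 * t) with hM
  obtain ⟨k₁, hk₁⟩ : ∃ k₁ : ℕ, Real.exp M ≤ k₁ := ⟨⌈Real.exp M⌉₊, Nat.le_ceil _⟩
  obtain ⟨k₂, hk₂⟩ : ∃ k₂ : ℕ, 1 / η ≤ k₂ := ⟨⌈1 / η⌉₊, Nat.le_ceil _⟩
  refine ⟨max 2 (max k₁ k₂), le_max_left _ _, fun k hk => ?_⟩
  have hk2 : (2 : ℕ) ≤ k := le_trans (le_max_left _ _) hk
  have hkk₁ : k₁ ≤ k := le_trans (le_trans (le_max_left _ _) (le_max_right _ _)) hk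
  have hkk₂ : k₂ ≤ k := le_trans (le_trans (le_max_right _ _) (le_max_right _ _)) hk
  have hkR : (2 : ℝ) ≤ (k : ℝ) := by exact_mod_cast hk2
  have hk0 : (0 : ℝ) < k := by linarith
  have hlogk : 0 < Real.log (k : ℝ) := Real.log_pos (by linarith)
  set K : ℝ := (k : ℝ) + 2 + 2 * t with hK
  have hK0 : 0 < K := by rw [hK]; linarith
  clear_value K
  have hKne : K ≠ 0 := hK0.ne'
  -- (1) balance hypothesis
  have hlarge : 2 * Real.log 2 - ((1 + t) * Real.log (1 + t) + t * Real.log t) ≤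
      (1 - 2 * t) * Real.log ((k : ℝ) + 1) := by
    rw [← hφ]
    have h12t : 0 < 1 - 2 * t := by linarith
    have hlogk1 : M ≤ Real.log ((k : ℝ) + 1) := by
      have hexp : Real.exp M ≤ (k : ℝ) + 1 := by
        have : (k₁ : ℝ) ≤ (k : ℝ) := by exact_mod_cast hkk₁
        linarith
      have := Real.log_le_log (Real.exp_pos M) hexp
      rwa [Real.log_exp] at this
    have := mul_le_mul_of_nonneg_left hlogk1 h12t.le
    have e : (1 - 2 * t) * M = 2 * Real.log 2 - φ := by rw [hM]; field_simp
    linarith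
  -- (2) slack 1/k ≤ η
  have hslack : 1 / (k : ℝ) ≤ η := by
    have hiη : 0 < 1 / η := by positivity
    have hk₂pos : (0 : ℝ) < k₂ := lt_of_lt_of_le hiη hk₂
    have hkk₂R : (k₂ : ℝ) ≤ (k : ℝ) := by exact_mod_cast hkk₂
    have h1 : 1 / (k : ℝ) ≤ 1 / (k₂ : ℝ) := div_le_div_of_nonneg_left zero_le_one hk₂pos hkk₂R
    have h2 : 1 / (k₂ : ℝ) ≤ η := by
      rw [div_le_iff₀ hk₂pos]
      have := (div_le_iff₀ hη0).mp hk₂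
      linarith
    exact h1.trans h2
  -- (3) the certificate at q = k, σ = t/K, ρ = 0
  have hcert := hC k k m s 0 hk2 (by omega) hm
  have hσ : ((s : ℝ) / (((k : ℝ) + 2) * m + 2 * s + ((0 : ℕ) : ℝ))) = t / K := by
    rw [Nat.cast_zero, add_zero, htdef, hK, htdef]
    field_simp
  have hρ : (((0 : ℕ) : ℝ) / (((k : ℝ) + 2) * m + 2 * s + ((0 : ℕ) : ℝ))) = 0 := by simp
  rw [hσ, hρ] at hcert
  -- rewrite the value
  have hβ : (1 - 2 * (t / K) - 0) / ((k : ℝ) + 2) = 1 / K := by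
    have hk2ne : (k : ℝ) + 2 ≠ 0 := by positivity
    field_simp
    rw [hK]; ring
  have eX1 : (k : ℝ) * (1 / K) + 2 * (t / K) = ((k : ℝ) + 2 * t) / K := by ring
  have eX2 : 2 * (1 / K) = 2 / K := by ring
  have eY1 : 1 / K + 0 + t / K = (1 + t) / K := by ring
  have eY2 : (k : ℝ) * (1 / K) + 1 / K = ((k : ℝ) + 1) / K := by ring
  have hbal : shannon₃ ((1 + t) / K) (((k : ℝ) + 1) / K) (t / K) ≤
      shannon₃ (((k : ℝ) + 2 * t) / K) (2 / K) 0 := by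
    rw [hK]; exact farEdge_balance hkR ht ht2 hlarge
  have hval : cwFullFirstPowerValue k k (t / K) 0 =
      (Real.log ((k : ℝ) + 2) -
          shannon₃ ((1 + t) / K) (((k : ℝ) + 1) / K) (t / K)) / (1 / K * Real.log (k : ℝ)) := by
    unfold cwFullFirstPowerValue
    rw [hβ, eX1, eX2, eY1, eY2, min_eq_right hbal]
  rw [hval] at hcert
  set S : ℝ := shannon₃ ((1 + t) / K) (((k : ℝ) + 1) / K) (t / K) with hS
  clear_value S
  -- (4) excess
  have hid : K * (Real.log ((k : ℝ) + 2) - S) - ((k : ℝ) + 1) * Real.log (k : ℝ) =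
      K * (Real.log ((k : ℝ) + 2) - Real.log K) + ((k : ℝ) + 1) * (Real.log ((k : ℝ) + 1) - Real.log (k : ℝ)) +
        φ := by
    rw [hS, hK, hφ]; exact farEdge_excess_identity hkR ht
  have hbd : K * (Real.log ((k : ℝ) + 2) - Real.log K) +
      ((k : ℝ) + 1) * (Real.log ((k : ℝ) + 1) - Real.log (k : ℝ)) + φ ≤ 1 - 2 * t + φ + 1 / (k : ℝ) := by
    rw [hK, hφ]; exact farEdge_excess_bound hkR ht
  have hmid : omegaRect ℂ 1 1 (k : ℝ) = omegaRect ℂ 1 (k : ℝ) 1 := (omegaRect_one_mid_one ℂ (k : ℝ)).symm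
  rw [hmid] at hcert
  -- value = (k+1) + Φ/log k with Φ ≤ 1 − 2t + φ + 1/k ≤ c − η
  have hΦ : K * (Real.log ((k : ℝ) + 2) - S) - ((k : ℝ) + 1) * Real.log (k : ℝ) ≤ c := by
    rw [hid]; linarith
  have hrew : (Real.log ((k : ℝ) + 2) - S) / (1 / K * Real.log (k : ℝ)) =
      (K * (Real.log ((k : ℝ) + 2) - S)) / Real.log (k : ℝ) := by
    field_simp
  rw [hrew] at hcert
  have hfin : (K * (Real.log ((k : ℝ) + 2) - S)) / Real.log (k : ℝ) ≤ c / Real.log (k : ℝ) + ((k : ℝ) + 1) := by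
    rw [div_add' _ _ _ hlogk.ne', div_le_div_iff_of_pos_right hlogk]
    linarith
  have hgoal : omegaRect ℂ 1 (k : ℝ) 1 - ((k : ℝ) + 1) ≤ c / Real.log (k : ℝ) := by linarith
  exact_mod_cast hgoal

/-- **The rung `LogRateSharp`, PROVED**: for every `c > c₁ = (3/2) log 3 − 2 log 2` there is `k₀ ≥ 2` with
`ω(1,k,1) − (k+1) ≤ c / log k` for all `k ≥ k₀` (the landed certificate `cwFirstPowerIntegerCertificate_holds`
evaluated along the dilute scalar rate).  Stated with the constant written out, exactly as the route aside. -/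
theorem logRateSharp_explicit :
    ∀ c : ℝ, 3 / 2 * Real.log 3 - 2 * Real.log 2 < c → ∃ k₀ : ℕ, 2 ≤ k₀ ∧ ∀ k : ℕ, k₀ ≤ k →
      omegaRect ℂ 1 k 1 - (k + 1) ≤ c / Real.log k :=
  logRateSharp_of_integerCertificate cwFirstPowerIntegerCertificate_holds

/-- **Aside `LogRateSharp` of route `FarEdgeDescent` (stmt-MatrixMultiplication-33239), by name.** -/
theorem logRateSharp : LogRateSharp := logRateSharp_explicit

/-! ## Placement of the open aside `SubLogRate` (stmt-MatrixMultiplication-25371) against the constant -/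

/-- Monotonicity of the rate rung in the constant. -/
theorem logRateAt_mono {c c' : ℝ} (h : c ≤ c')
    (hc : ∃ k₀ : ℕ, 2 ≤ k₀ ∧ ∀ k : ℕ, k₀ ≤ k → omegaRect ℂ 1 k 1 - (k + 1) ≤ c / Real.log k) :
    ∃ k₀ : ℕ, 2 ≤ k₀ ∧ ∀ k : ℕ, k₀ ≤ k → omegaRect ℂ 1 k 1 - (k + 1) ≤ c' / Real.log k := by
  obtain ⟨k₀, hk₀, H⟩ := hc
  refine ⟨k₀, hk₀, fun k hk => (H k hk).trans ?_⟩
  have hk2 : (2 : ℝ) ≤ k := by exact_mod_cast hk₀.trans hk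
  exact div_le_div_of_nonneg_right h (Real.log_nonneg (by linarith))

/-- `SubLogRate` (25371: every `c > 0`) implies the rung (33239: every `c > c₁`): the new aside sits BELOW 25371
on the ladder (by name). -/
theorem logRateSharp_of_subLogRate (h : SubLogRate) : LogRateSharp := by
  intro c hc
  have hc0 : 0 < c := lt_trans cwFarEdgeConstant_pos hc
  exact h c hc0

/-- **The rate leaf lives at or below the constant.** `SubLogRate ⟺ ∀ c ∈ (0, c₁], eventually e(k) ≤ c / log k`:
everything the fixed-power `CW_q` class certifies (`c > c₁`, `logRateSharp_explicit`) is already a theorem, so the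
open content of aside 25371 is exactly the family of rungs with constant `c ≤ c₁`. -/
theorem subLogRate_iff_below_constant :
    SubLogRate ↔ ∀ c : ℝ, 0 < c → c ≤ 3 / 2 * Real.log 3 - 2 * Real.log 2 → ∃ k₀ : ℕ, 2 ≤ k₀ ∧ ∀ k : ℕ, k₀ ≤ k →
      omegaRect ℂ 1 k 1 - (k + 1) ≤ c / Real.log k := by
  constructor
  · exact fun h c hc _ => h c hc
  · intro h c hc
    rcases le_or_gt c (3 / 2 * Real.log 3 - 2 * Real.log 2) with hle | hlt
    · exact h c hc hle
    · exact logRateSharp_explicit c hlt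

/-- Equivalently: `SubLogRate` is ONE rung at the constant itself together with all rungs below it; in particular
`SubLogRate → eventually e(k) ≤ c₁ / log k`, the first statement past the class. -/
theorem halfOpen_rung_of_subLogRate (h : SubLogRate) :
    ∃ k₀ : ℕ, 2 ≤ k₀ ∧ ∀ k : ℕ, k₀ ≤ k →
      omegaRect ℂ 1 k 1 - (k + 1) ≤ (3 / 2 * Real.log 3 - 2 * Real.log 2) / Real.log k :=
  h _ cwFarEdgeConstant_pos

end Summit.MatrixMultiplication.MatrixMultiplication.Theorems.FarEdgeDescentLogRateSharp

end
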